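import Summits.QuantumFields.YangMills.Theorems.FradkinShenkerFlowFiniteSusceptibilityWeakCouplingOddSector
import HarnessLib

/-!
# STUB 0 of line `purity-rate-split` reduces to the reflection-even sector (item stmt-QuantumFields-9442)

Support file for item stmt-QuantumFields-9442 (route `FradkinShenkerFlow` of `YangMills`), crux
`Summit.QuantumFields.YangMills.Theses.FradkinShenkerFlow.FiniteSusceptibilityWeakCoupling`, line `purity-rate-split`
(lead c20 reshape). Write `K(X,Y)(n) = ⟨X · τ_{n e₀} Y⟩_{β,2S+1} − ⟨X⟩⟨Y⟩` (`latticeConnectedCorr`) and `D_X(n) = K(X, X∘Θ)(n)`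
(the mirror correlator of STUB 0). For a species `A` put `P = A + A∘Θ` (reflection-even) and `M = A − A∘Θ`
(reflection-odd). Then, for every compact `G` and every `β ≥ 0`:

* `4·D_A = K(P,P) − K(M,M) + K(M,P) − K(P,M)` (bilinearity; `EvenReduction.four_mul_mirrorCorr_eq`), and `−K(M,M) = D_M`;
* the cross terms are dominated by a three-lag window of `|D_M| + |D_M| + |K(P,P)|`, resp. `|K(P,P)| + |K(P,P)| + |D_M|`
  (landed explicit-pair mirror domination `MirrorFunnel.abs_cov_axial_le_mirror`, with `K(Pᴿ,P) = K(P,P)` for even `P` and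
  `K(Mᴿ,M) = D_M` for odd `M`);
* so if the even species `P` decorrelates from ITSELF along the time axis (the reshaped STUB 0′ at `β`) and the odd species
  `M` has no mirror long-range order (a THEOREM: `…OddSector.lean`), then `A` has no mirror long-range order
(`EvenReduction.noMirrorLRO_of_even_of` with the odd-sector decorrelation as a hypothesis; the registered
  `stub_noMirrorLRO_of_even` discharges it by the landed `stub_oddSpeciesNoMirrorLRO`, `…OddSector.lean`).

No definition is introduced; nothing here is a named fact. [folklore]
-/

noncomputable section

open MeasureTheory ProbabilityTheory Finset
open Literature.MathematicalPhysics.QuantumFieldTheory hiding Site ZdEdge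
open Literature.MathematicalPhysics.QuantumLattice
open Literature.Probability.LatticeModels hiding configShift configShift_apply

namespace Summit.QuantumFields.YangMills.Theorems.FiniteSusceptibilityWeakCoupling

namespace EvenReduction

open MirrorDominationAxis0 MirrorLogConvex OddSector

variable {G : Type} [Group G] [TopologicalSpace G] [IsTopologicalGroup G] [CompactSpace G]
  [MeasurableSpace G] [BorelSpace G]

/-! ## §1 Square-integrability of lifted species -/

/-- A species read on the translated periodic lift is square-integrable under the torus Wilson state (bounded and
measurable under a probability measure). [folklore] -/
theorem memLp_shift_lift (r : LatticeRep G) (β : ℝ) (X : YMSpecies G) (S : ℕ) (x : Site 4) :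
    MemLp (fun U : GaugeConfig 4 (2 * S + 1) G => X.F (configShift x (torusLift (2 * S + 1) U))) 2
      (wilsonMeasure (d := 4) (L := 2 * S + 1) r.ρ β) := by
  haveI : IsProbabilityMeasure (wilsonMeasure (d := 4) (L := 2 * S + 1) r.ρ β) :=
    isProbabilityMeasure_wilsonMeasure _ r.continuous β
  obtain ⟨a, ha⟩ := X.bounded
  have hm : Measurable fun U : GaugeConfig 4 (2 * S + 1) G => X.F (configShift x (torusLift (2 * S + 1) U)) :=
    X.measurable.comp ((configShift _).measurable.comp (measurable_torusLift _))
  exact MemLp.of_bound hm.aestronglyMeasurable a (ae_of_all _ fun U => by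
    simpa [Real.norm_eq_abs] using ha _)

/-- A species read on the periodic lift is square-integrable under the torus Wilson state. [folklore] -/
theorem memLp_lift (r : LatticeRep G) (β : ℝ) (X : YMSpecies G) (S : ℕ) :
    MemLp (fun U : GaugeConfig 4 (2 * S + 1) G => X.F (torusLift (2 * S + 1) U)) 2
      (wilsonMeasure (d := 4) (L := 2 * S + 1) r.ρ β) := by
  simpa only [configShift_zero] using memLp_shift_lift r β X S 0

/-! ## §2 The four-term decomposition of the mirror correlator -/

/-- **`4·D_A = K(P,P) − K(M,M) + K(M,P) − K(P,M)`** for `P = A + A∘Θ`, `M = A − A∘Θ` (pointwise, as species): bilinearity of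
the covariance, `A = ½(P + M)`, `A∘Θ = ½(P − M)`. Every `β`, every compact `G`. [folklore] -/
theorem four_mul_mirrorCorr_eq (r : LatticeRep G) (β : ℝ) (A P M : YMSpecies G)
    (hP : ∀ V, P.F V = A.F V + A.F (cfgReflect V)) (hM : ∀ V, M.F V = A.F V - A.F (cfgReflect V)) (S n : ℕ) :
    4 * latticeConnectedCorr r.ρ β (2 * S + 1) A.F (fun V => A.F (cfgReflect V)) n =
      latticeConnectedCorr r.ρ β (2 * S + 1) P.F P.F n - latticeConnectedCorr r.ρ β (2 * S + 1) M.F M.F n +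
        latticeConnectedCorr r.ρ β (2 * S + 1) M.F P.F n - latticeConnectedCorr r.ρ β (2 * S + 1) P.F M.F n := by
  haveI : IsProbabilityMeasure (wilsonMeasure (d := 4) (L := 2 * S + 1) r.ρ β) :=
    isProbabilityMeasure_wilsonMeasure _ r.continuous β
  have eA : cov[fun U => A.F (torusLift (2 * S + 1) U),
      fun U => A.F (cfgReflect (configShift (-(Pi.single 0 (n : ℤ))) (torusLift (2 * S + 1) U)));
      wilsonMeasure (d := 4) (L := 2 * S + 1) r.ρ β] =
      latticeConnectedCorr r.ρ β (2 * S + 1) A.F (fun V => A.F (cfgReflect V)) n :=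
    SiblingFunnel.covariance_eq_latticeConnectedCorr r β A (reflSpecies A) S n
  rw [← eA, ← SiblingFunnel.covariance_eq_latticeConnectedCorr r β P P S n,
    ← SiblingFunnel.covariance_eq_latticeConnectedCorr r β M M S n,
    ← SiblingFunnel.covariance_eq_latticeConnectedCorr r β M P S n,
    ← SiblingFunnel.covariance_eq_latticeConnectedCorr r β P M S n]
  set fP : GaugeConfig 4 (2 * S + 1) G → ℝ := fun U => P.F (torusLift (2 * S + 1) U) with hfP
  set fM : GaugeConfig 4 (2 * S + 1) G → ℝ := fun U => M.F (torusLift (2 * S + 1) U) with hfM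
  set gP : GaugeConfig 4 (2 * S + 1) G → ℝ :=
    fun U => P.F (configShift (-(Pi.single 0 (n : ℤ))) (torusLift (2 * S + 1) U)) with hgP
  set gM : GaugeConfig 4 (2 * S + 1) G → ℝ :=
    fun U => M.F (configShift (-(Pi.single 0 (n : ℤ))) (torusLift (2 * S + 1) U)) with hgM
  have hfA : (fun U : GaugeConfig 4 (2 * S + 1) G => A.F (torusLift (2 * S + 1) U)) =
      (1 / 2 : ℝ) • (fP + fM) := by
    funext U
    simp only [hfP, hfM, Pi.smul_apply, Pi.add_apply, smul_eq_mul]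
    linarith [hP (torusLift (2 * S + 1) U), hM (torusLift (2 * S + 1) U)]
  have hgA : (fun U : GaugeConfig 4 (2 * S + 1) G =>
      A.F (cfgReflect (configShift (-(Pi.single 0 (n : ℤ))) (torusLift (2 * S + 1) U)))) =
      (1 / 2 : ℝ) • (gP - gM) := by
    funext U
    simp only [hgP, hgM, Pi.smul_apply, Pi.sub_apply, smul_eq_mul]
    linarith [hP (configShift (-(Pi.single 0 (n : ℤ))) (torusLift (2 * S + 1) U)),
      hM (configShift (-(Pi.single 0 (n : ℤ))) (torusLift (2 * S + 1) U))]
  have mfP : MemLp fP 2 (wilsonMeasure (d := 4) (L := 2 * S + 1) r.ρ β) := memLp_lift r β P S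
  have mfM : MemLp fM 2 (wilsonMeasure (d := 4) (L := 2 * S + 1) r.ρ β) := memLp_lift r β M S
  have mgP : MemLp gP 2 (wilsonMeasure (d := 4) (L := 2 * S + 1) r.ρ β) := memLp_shift_lift r β P S _
  have mgM : MemLp gM 2 (wilsonMeasure (d := 4) (L := 2 * S + 1) r.ρ β) := memLp_shift_lift r β M S _
  rw [hfA, hgA, covariance_smul_left, covariance_smul_right, covariance_add_left mfP mfM (mgP.sub mgM),
    covariance_sub_right mfP mgP mgM, covariance_sub_right mfM mgP mgM]
  ring

/-! ## §3 Even and odd bookkeeping -/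

omit [TopologicalSpace G] [IsTopologicalGroup G] [CompactSpace G] [BorelSpace G] in
/-- `P = A + A∘Θ` is reflection-even. [folklore] -/
theorem even_of_sum (A P : YMSpecies G) (hP : ∀ V, P.F V = A.F V + A.F (cfgReflect V)) (V : LGConfig 4 G) :
    P.F (cfgReflect V) = P.F V := by
  rw [hP, hP, cfgReflect_cfgReflect, add_comm]

omit [TopologicalSpace G] [IsTopologicalGroup G] [CompactSpace G] [BorelSpace G] in
/-- `M = A − A∘Θ` is reflection-odd. [folklore] -/
theorem odd_of_diff (A M : YMSpecies G) (hM : ∀ V, M.F V = A.F V - A.F (cfgReflect V)) (V : LGConfig 4 G) :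
    M.F (cfgReflect V) = -M.F V := by
  rw [hM, hM, cfgReflect_cfgReflect]
  ring

/-! ## §4 The cross terms die: explicit-pair mirror domination -/

/-- **Cross terms.** For species `X, Y`, if the mirror correlator of `X`, the swapped correlator of `X` and the swapped
correlator of `Y` are eventually `≤ δ` in absolute value uniformly in the odd tori, then so is `9·|K(X,Y)|`... precisely
`|K(X,Y)(n)| ≤ 9δ` for `n` beyond a threshold — the landed three-lag window `MirrorFunnel.abs_cov_axial_le_mirror`
(each window term `≤ 3δ`, at most three lags). [folklore] -/
theorem abs_corr_le_of_eventually (r : LatticeRep G) {β : ℝ} (hβ : 0 ≤ β) (X Y : YMSpecies G) {δ : ℝ} (hδ : 0 ≤ δ)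
    {j₁ j₂ j₃ : ℕ}
    (h₁ : ∀ S j : ℕ, j₁ ≤ j → j ≤ S →
      |latticeConnectedCorr r.ρ β (2 * S + 1) X.F (fun V => X.F (cfgReflect V)) j| ≤ δ)
    (h₂ : ∀ S j : ℕ, j₂ ≤ j → j ≤ S →
      |latticeConnectedCorr r.ρ β (2 * S + 1) (fun V => X.F (cfgReflect V)) X.F j| ≤ δ)
    (h₃ : ∀ S j : ℕ, j₃ ≤ j → j ≤ S →
      |latticeConnectedCorr r.ρ β (2 * S + 1) (fun V => Y.F (cfgReflect V)) Y.F j| ≤ δ) :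
    ∃ n₀ : ℕ, ∀ S n : ℕ, n₀ ≤ n → n ≤ S → |latticeConnectedCorr r.ρ β (2 * S + 1) X.F Y.F n| ≤ 9 * δ := by
  obtain ⟨n₁, hdom⟩ := MirrorFunnel.abs_cov_axial_le_mirror r hβ X Y
  refine ⟨max n₁ (max j₁ (max j₂ j₃) + 1), fun S n hn hnS => ?_⟩
  have hn₁ : n₁ ≤ n := le_trans (le_max_left _ _) hn
  have hnj : max j₁ (max j₂ j₃) + 1 ≤ n := le_trans (le_max_right _ _) hn
  have key := hdom S n hn₁ hnS
  rw [SiblingFunnel.covariance_eq_latticeConnectedCorr r β X Y S n] at key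
  have e0 : ∀ j : ℕ, cov[fun U => X.F (torusLift (2 * S + 1) U),
      fun U => X.F (cfgReflect (configShift (-(Pi.single 0 (j : ℤ))) (torusLift (2 * S + 1) U)));
      wilsonMeasure (d := 4) (L := 2 * S + 1) r.ρ β] =
      latticeConnectedCorr r.ρ β (2 * S + 1) X.F (fun V => X.F (cfgReflect V)) j :=
    fun j => SiblingFunnel.covariance_eq_latticeConnectedCorr r β X (reflSpecies X) S j
  have e1 : ∀ j : ℕ, cov[fun U => X.F (cfgReflect (torusLift (2 * S + 1) U)),
      fun U => X.F (configShift (-(Pi.single 0 (j : ℤ))) (torusLift (2 * S + 1) U));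
      wilsonMeasure (d := 4) (L := 2 * S + 1) r.ρ β] =
      latticeConnectedCorr r.ρ β (2 * S + 1) (fun V => X.F (cfgReflect V)) X.F j :=
    fun j => SiblingFunnel.covariance_eq_latticeConnectedCorr r β (reflSpecies X) X S j
  have e2 : ∀ j : ℕ, cov[fun U => Y.F (cfgReflect (torusLift (2 * S + 1) U)),
      fun U => Y.F (configShift (-(Pi.single 0 (j : ℤ))) (torusLift (2 * S + 1) U));
      wilsonMeasure (d := 4) (L := 2 * S + 1) r.ρ β] =
      latticeConnectedCorr r.ρ β (2 * S + 1) (fun V => Y.F (cfgReflect V)) Y.F j :=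
    fun j => SiblingFunnel.covariance_eq_latticeConnectedCorr r β (reflSpecies Y) Y S j
  simp only [e0, e1, e2] at key
  set W := (range (S + 1)).filter (fun j => n ≤ j + 1 ∧ j ≤ n + 1) with hW
  have hterm : ∀ j ∈ W,
      |latticeConnectedCorr r.ρ β (2 * S + 1) X.F (fun V => X.F (cfgReflect V)) j| +
        |latticeConnectedCorr r.ρ β (2 * S + 1) (fun V => X.F (cfgReflect V)) X.F j| +
        |latticeConnectedCorr r.ρ β (2 * S + 1) (fun V => Y.F (cfgReflect V)) Y.F j| ≤ 3 * δ := by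
    intro j hj
    rw [hW, mem_filter, mem_range] at hj
    have hjS : j ≤ S := by omega
    have a1 := h₁ S j (by omega) hjS
    have a2 := h₂ S j (by omega) hjS
    have a3 := h₃ S j (by omega) hjS
    linarith
  have hcard : W.card ≤ 3 := by
    calc W.card ≤ (Icc (n - 1) (n + 1)).card := by
          refine card_le_card fun j hj => ?_
          rw [hW, mem_filter, mem_range] at hj
          rw [mem_Icc]; omega
      _ = 3 := by rw [Nat.card_Icc]; omega
  calc |latticeConnectedCorr r.ρ β (2 * S + 1) X.F Y.F n|
      ≤ ∑ j ∈ W, (|latticeConnectedCorr r.ρ β (2 * S + 1) X.F (fun V => X.F (cfgReflect V)) j| +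
          |latticeConnectedCorr r.ρ β (2 * S + 1) (fun V => X.F (cfgReflect V)) X.F j| +
          |latticeConnectedCorr r.ρ β (2 * S + 1) (fun V => Y.F (cfgReflect V)) Y.F j|) := key
    _ ≤ ∑ _j ∈ W, 3 * δ := sum_le_sum hterm
    _ = W.card * (3 * δ) := by rw [sum_const, nsmul_eq_mul]
    _ ≤ 3 * (3 * δ) := by
          have h3 : (W.card : ℝ) ≤ 3 := by exact_mod_cast hcard
          exact mul_le_mul_of_nonneg_right h3 (by positivity)
    _ = 9 * δ := by ring

/-! ## §5 Assembly -/

/-- **STUB 0 for `A` from the even part `P` and the odd part `M`** (every compact `G`, `β ≥ 0`): if `P = A + A∘Θ` decorrelates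
from itself along the time axis and `M = A − A∘Θ` has no mirror long-range order (both uniformly in the odd tori), then `A`
has no mirror long-range order. `4|D_A| ≤ |K(P,P)| + |D_M| + |K(M,P)| + |K(P,M)| ≤ (1 + 1 + 9 + 9)·ε/20`. [folklore] -/
theorem noMirrorLRO_of_even_of (r : LatticeRep G) {β : ℝ} (hβ : 0 ≤ β) (A P M : YMSpecies G)
    (hP : ∀ V, P.F V = A.F V + A.F (cfgReflect V)) (hM : ∀ V, M.F V = A.F V - A.F (cfgReflect V))
    (hPdec : ∀ ε : ℝ, 0 < ε → ∃ j₀ : ℕ, ∀ S j : ℕ, j₀ ≤ j → j ≤ S →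
      |latticeConnectedCorr r.ρ β (2 * S + 1) P.F P.F j| ≤ ε)
    (hMdec : ∀ ε : ℝ, 0 < ε → ∃ j₀ : ℕ, ∀ S j : ℕ, j₀ ≤ j → j ≤ S →
      |latticeConnectedCorr r.ρ β (2 * S + 1) M.F (fun V => M.F (cfgReflect V)) j| ≤ ε)
    {ε : ℝ} (hε : 0 < ε) :
    ∃ j₀ : ℕ, ∀ S j : ℕ, j₀ ≤ j → j ≤ S →
      |latticeConnectedCorr r.ρ β (2 * S + 1) A.F (fun V => A.F (cfgReflect V)) j| ≤ ε := by
  have hPeven : ∀ V, P.F (cfgReflect V) = P.F V := even_of_sum A P hP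
  have hModd : ∀ V, M.F (cfgReflect V) = -M.F V := odd_of_diff A M hM
  have hPF : (fun V => P.F (cfgReflect V)) = P.F := funext hPeven
  have hδ : 0 < ε / 20 := by positivity
  obtain ⟨jP, hjP⟩ := hPdec (ε / 20) hδ
  obtain ⟨jM, hjM⟩ := hMdec (ε / 20) hδ
  -- the three kinds of window terms, all `≤ ε/20` beyond `max jP jM`
  have hP1 : ∀ S j : ℕ, max jP jM ≤ j → j ≤ S →
      |latticeConnectedCorr r.ρ β (2 * S + 1) P.F (fun V => P.F (cfgReflect V)) j| ≤ ε / 20 :=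
    fun S j hj hjS => by rw [hPF]; exact hjP S j ((le_max_left _ _).trans hj) hjS
  have hP2 : ∀ S j : ℕ, max jP jM ≤ j → j ≤ S →
      |latticeConnectedCorr r.ρ β (2 * S + 1) (fun V => P.F (cfgReflect V)) P.F j| ≤ ε / 20 :=
    fun S j hj hjS => by rw [hPF]; exact hjP S j ((le_max_left _ _).trans hj) hjS
  have hM1 : ∀ S j : ℕ, max jP jM ≤ j → j ≤ S →
      |latticeConnectedCorr r.ρ β (2 * S + 1) M.F (fun V => M.F (cfgReflect V)) j| ≤ ε / 20 :=
    fun S j hj hjS => hjM S j ((le_max_right _ _).trans hj) hjS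
  have hM2 : ∀ S j : ℕ, max jP jM ≤ j → j ≤ S →
      |latticeConnectedCorr r.ρ β (2 * S + 1) (fun V => M.F (cfgReflect V)) M.F j| ≤ ε / 20 :=
    fun S j hj hjS => by
      rw [swappedCorr_eq_neg_autocorr r β M hModd, ← mirrorCorr_eq_neg_autocorr r β M hModd]
      exact hjM S j ((le_max_right _ _).trans hj) hjS
  obtain ⟨nMP, hMP⟩ := abs_corr_le_of_eventually r hβ M P hδ.le hM1 hM2 hP2
  obtain ⟨nPM, hPM⟩ := abs_corr_le_of_eventually r hβ P M hδ.le hP1 hP2 hM2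
  refine ⟨max (max jP jM) (max nMP nPM), fun S j hj hjS => ?_⟩
  have hjPM : max jP jM ≤ j := (le_max_left _ _).trans hj
  have h4 := four_mul_mirrorCorr_eq r β A P M hP hM S j
  have t1 : |latticeConnectedCorr r.ρ β (2 * S + 1) P.F P.F j| ≤ ε / 20 :=
    hjP S j ((le_max_left _ _).trans hjPM) hjS
  have t2 : |latticeConnectedCorr r.ρ β (2 * S + 1) M.F M.F j| ≤ ε / 20 := by
    have := hM1 S j hjPM hjS
    rwa [mirrorCorr_eq_neg_autocorr r β M hModd, abs_neg] at this
  have t3 : |latticeConnectedCorr r.ρ β (2 * S + 1) M.F P.F j| ≤ 9 * (ε / 20) :=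
    hMP S j ((le_max_left _ _).trans ((le_max_right _ _).trans hj)) hjS
  have t4 : |latticeConnectedCorr r.ρ β (2 * S + 1) P.F M.F j| ≤ 9 * (ε / 20) :=
    hPM S j ((le_max_right _ _).trans ((le_max_right _ _).trans hj)) hjS
  have habs : 4 * |latticeConnectedCorr r.ρ β (2 * S + 1) A.F (fun V => A.F (cfgReflect V)) j| ≤
      ε / 20 + ε / 20 + 9 * (ε / 20) + 9 * (ε / 20) := by
    rw [show (4 : ℝ) * |latticeConnectedCorr r.ρ β (2 * S + 1) A.F (fun V => A.F (cfgReflect V)) j| =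
        |4 * latticeConnectedCorr r.ρ β (2 * S + 1) A.F (fun V => A.F (cfgReflect V)) j| by
      rw [abs_mul, abs_of_pos (by norm_num : (0 : ℝ) < 4)], h4]
    refine (abs_sub _ _).trans (add_le_add ((abs_add_le _ _).trans (add_le_add ((abs_sub _ _).trans
      (add_le_add t1 t2)) t3)) t4) |>.trans_eq ?_
    ring
  linarith

end EvenReduction

/-- **Registered sub-goal `stub_noMirrorLRO_of_even`** of item stmt-QuantumFields-9442 (signature verbatim, fully qualified) —
**STUB 0 of line `purity-rate-split` reduces to the reflection-even sector**: for every compact `G`, every `β ≥ 0` and every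
species `A` with even part `P = A + A∘Θ` and odd part `M = A − A∘Θ` (as species), time-axis decorrelation of `P` from itself,
uniformly in the odd tori, implies that `A` has no mirror long-range order — the odd part never orders
(`stub_oddSpeciesNoMirrorLRO`) and the cross terms are dominated by mirror terms (`MirrorFunnel.abs_cov_axial_le_mirror`). [folklore] -/
theorem stub_noMirrorLRO_of_even : ∀ (G : Type) [Group G] [TopologicalSpace G] [IsTopologicalGroup G] [CompactSpace G] [MeasurableSpace G] [BorelSpace G] (r : Literature.MathematicalPhysics.QuantumFieldTheory.LatticeRep G) (β : ℝ), 0 ≤ β → ∀ A P M : Literature.MathematicalPhysics.QuantumFieldTheory.YMSpecies G, (∀ V, P.F V = A.F V + A.F (Literature.MathematicalPhysics.QuantumFieldTheory.cfgReflect V)) → (∀ V, M.F V = A.F V - A.F (Literature.MathematicalPhysics.QuantumFieldTheory.cfgReflect V)) → (∀ ε : ℝ, 0 < ε → ∃ j₀ : ℕ, ∀ S j : ℕ, j₀ ≤ j → j ≤ S → |Literature.MathematicalPhysics.QuantumFieldTheory.latticeConnectedCorr r.ρ β (2 * S + 1) P.F P.F j| ≤ ε) → ∀ ε : ℝ, 0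 < ε → ∃ j₀ : ℕ, ∀ S j : ℕ, j₀ ≤ j → j ≤ S → |Literature.MathematicalPhysics.QuantumFieldTheory.latticeConnectedCorr r.ρ β (2 * S + 1) A.F (fun V => A.F (Literature.MathematicalPhysics.QuantumFieldTheory.cfgReflect V)) j| ≤ ε := by
  intro G _ _ _ _ _ _ r β hβ A P M hP hM hPdec ε hε
  exact EvenReduction.noMirrorLRO_of_even_of r hβ A P M hP hM hPdec
    (fun δ hδ => oddPart_noMirrorLRO r hβ A M hM hδ) hε

end Summit.QuantumFields.YangMills.Theorems.FiniteSusceptibilityWeakCoupling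

end
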